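import Literature.NumberTheory.Sieve.HeathBrownIdentityMoebius
import Literature.NumberTheory.Sieve.VaughanMeanValueDecomposition
import Literature.NumberTheory.LFunctions.LiouvilleSumClassicalBound
import HarnessLib

/-!
# Heath-Brown's identity for the Liouville function

Topic `Literature/NumberTheory/Sieve`; theorems only (plus the bookkeeping definitions of the factors),
everything PROVED.  Since `λ = 1_□ ⋆ μ` (`LiouvilleSum.coe_liouville_eq_zeta_mul_liouville_mul_moebius`),
Heath-Brown's identity for `μ` (`heathBrown_identity_moebius`, Canad. J. Math. 34 (1982) Lemma 1 in its
Möbius form) gives, for `k ≥ 1`, `z ≥ 0`, a squares cutoff `K` and every `1 ≤ m ≤ z^k`,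

`λ(m) = ∑_{j=1}^{k} (−1)^{j+1} C(k,j) (1_{□,≤K} ⋆ μ_{≤z}^{⋆j} ⋆ ζ^{⋆(j−1)})(m) + (1_{□,>K} ⋆ μ)(m)`

(`liouville_apply_eq`), the `j`-th piece being the Dirichlet product of the `2j` factors
`hbFactor K ⌊z⌋ j i` (`i = 0`: `1_{□,≤K}`; `1 ≤ i ≤ j`: `μ_{≤z}`; `j < i < 2j`: `ζ`), each bounded by `1`
(`prod_range_hbFactor`, `abs_hbFactor_le_one`).  This is the decomposition of `λ` into Type I/II sums used for
correlations of `λ` (Drappeau, PLMS 114 (2017) §6.2 does the same for `τ`-type coefficients; Matomäki–Radziwiłł–Tao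
use it for `λ`), written so that the box machinery of `BombieriFriedlanderIwaniecBoxes` applies verbatim.

## References

* D. R. Heath-Brown, Canad. J. Math. 34 (1982), 1365–1377, Lemma 1. [Heathbrown1982]
-/

open Finset
open scoped ArithmeticFunction.Moebius ArithmeticFunction.zeta ArithmeticFunction.Omega

noncomputable section

namespace Literature.NumberTheory.Sieve

namespace HeathBrownLiouville

open ArithmeticFunction Literature.NumberTheory.LFunctions

/-! ### The indicator of the squares and its truncations -/

/-- `1_□ = ζ ⋆ λ` as a real arithmetic function. [folklore] -/
def sqInd : ArithmeticFunction ℝ :=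
  (ζ : ArithmeticFunction ℝ) * (liouville : ArithmeticFunction ℝ)

/-- `1_□(n) = [n is a nonzero square]`. [folklore] -/
theorem sqInd_apply (n : ℕ) : sqInd n = if n ≠ 0 ∧ IsSquare n then 1 else 0 := by
  rcases eq_or_ne n 0 with rfl | hn
  · simp [sqInd]
  · rw [sqInd, LiouvilleSum.zeta_mul_liouville_apply hn]
    simp [hn]

/-- `0 ≤ 1_□ ≤ 1`. [folklore] -/
theorem sqInd_mem (n : ℕ) : sqInd n = 0 ∨ sqInd n = 1 := by
  rw [sqInd_apply]; split_ifs <;> simp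

/-- `1_{□, ≤ K}`. [folklore] -/
def sqIndLe (K : ℕ) : ArithmeticFunction ℝ :=
  ⟨fun n => if n ≤ K then sqInd n else 0, by simp⟩

/-- `1_{□, > K}`. [folklore] -/
def sqIndGt (K : ℕ) : ArithmeticFunction ℝ :=
  ⟨fun n => if n ≤ K then 0 else sqInd n, by simp⟩

/-- Unfolding `sqIndLe`. [folklore] -/
theorem sqIndLe_apply (K n : ℕ) : sqIndLe K n = if n ≤ K then sqInd n else 0 := rfl

/-- Unfolding `sqIndGt`. [folklore] -/
theorem sqIndGt_apply (K n : ℕ) : sqIndGt K n = if n ≤ K then 0 else sqInd n := rfl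

/-- `1_□ = 1_{□,≤K} + 1_{□,>K}`. [folklore] -/
theorem sqIndLe_add_sqIndGt (K : ℕ) : sqIndLe K + sqIndGt K = sqInd := by
  ext n
  rw [ArithmeticFunction.add_apply, sqIndLe_apply, sqIndGt_apply]
  split_ifs <;> simp

/-! ### The factors of the Heath-Brown–Liouville pieces -/

/-- The `i`-th factor of the `j`-th piece `1_{□,≤K} ⋆ μ_{≤U}^{⋆j} ⋆ ζ^{⋆(j−1)}`: `1_{□,≤K}` for `i = 0`,
`μ_{≤U}` for `1 ≤ i ≤ j`, `ζ` for `j < i`. [cite: Heathbrown1982, Lemma 1] -/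
def hbFactor (K U j i : ℕ) : ArithmeticFunction ℝ :=
  if i = 0 then sqIndLe K else if i ≤ j then (moebiusTrunc U : ArithmeticFunction ℝ) else ζ

/-- Every factor is bounded by `1` in absolute value. [folklore] -/
theorem abs_hbFactor_le_one (K U j i n : ℕ) : |hbFactor K U j i n| ≤ 1 := by
  unfold hbFactor
  split_ifs with h0 h1
  · rw [sqIndLe_apply]
    split_ifs
    · rcases sqInd_mem n with h | h <;> rw [h] <;> simp
    · simp
  · rw [ArithmeticFunction.intCoe_apply, moebiusTrunc_apply]
    split_ifs
    · exact_mod_cast ArithmeticFunction.abs_moebius_le_one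
    · simp
  · rw [ArithmeticFunction.natCoe_apply, ArithmeticFunction.zeta_apply]
    split_ifs <;> simp

/-- The `μ_{≤U}`-factors vanish above `U`. [folklore] -/
theorem hbFactor_moebius_eq_zero {K U j i n : ℕ} (hi : 1 ≤ i) (hij : i ≤ j) (hn : U < n) :
    hbFactor K U j i n = 0 := by
  unfold hbFactor
  rw [if_neg (by omega), if_pos hij, ArithmeticFunction.intCoe_apply, moebiusTrunc_apply, if_neg (by omega)]
  simp

/-- The `1_{□,≤K}`-factor vanishes above `K`. [folklore] -/
theorem hbFactor_zero_eq_zero {K U j n : ℕ} (hn : K < n) : hbFactor K U j 0 n = 0 := by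
  unfold hbFactor
  rw [if_pos rfl, sqIndLe_apply, if_neg (by omega)]

/-- The `ζ`-factors are `1` on positive integers. [folklore] -/
theorem hbFactor_zeta_apply {K U j i n : ℕ} (hij : j < i) (hn : n ≠ 0) : hbFactor K U j i n = 1 := by
  unfold hbFactor
  rw [if_neg (by omega), if_neg (by omega), ArithmeticFunction.natCoe_apply, ArithmeticFunction.zeta_apply,
    if_neg hn]
  simp

/-- `∏_{i < 2j} hbFactor K U j i = 1_{□,≤K} ⋆ μ_{≤U}^{⋆j} ⋆ ζ^{⋆(j−1)}` for `j ≥ 1`. [cite: Heathbrown1982, Lemma 1] -/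
theorem prod_range_hbFactor (K U : ℕ) {j : ℕ} (hj : 1 ≤ j) :
    ∏ i ∈ Finset.range (2 * j), hbFactor K U j i =
      sqIndLe K * (moebiusTrunc U : ArithmeticFunction ℝ) ^ j * (ζ : ArithmeticFunction ℝ) ^ (j - 1) := by
  -- adapted from `BFI.hbPiece_eq_prod_hbFactor`: split `[0, 2j) = {0} ∪ [1, j] ∪ (j, 2j)`
  have h2j : 2 * j = (j + 1) + (j - 1) := by omega
  rw [h2j, Finset.prod_range_add, Finset.prod_range_succ']
  have h1 : ∏ i ∈ Finset.range j, hbFactor K U j (i + 1) = (moebiusTrunc U : ArithmeticFunction ℝ) ^ j := by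
    calc ∏ i ∈ Finset.range j, hbFactor K U j (i + 1)
        = ∏ _i ∈ Finset.range j, (moebiusTrunc U : ArithmeticFunction ℝ) := by
          refine Finset.prod_congr rfl fun i hi => ?_
          rw [Finset.mem_range] at hi
          rw [hbFactor, if_neg (by omega), if_pos (by omega)]
      _ = _ := by rw [Finset.prod_const, Finset.card_range]
  have h2 : ∏ i ∈ Finset.range (j - 1), hbFactor K U j (j + 1 + i) = (ζ : ArithmeticFunction ℝ) ^ (j - 1) := by
    calc ∏ i ∈ Finset.range (j - 1), hbFactor K U j (j + 1 + i)
        = ∏ _i ∈ Finset.range (j - 1), (ζ : ArithmeticFunction ℝ) := by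
          refine Finset.prod_congr rfl fun i _ => ?_
          rw [hbFactor, if_neg (by omega), if_neg (by omega)]
      _ = _ := by rw [Finset.prod_const, Finset.card_range]
  have h0 : hbFactor K U j 0 = sqIndLe K := by rw [hbFactor, if_pos rfl]
  rw [h1, h0, h2]
  ring

/-! ### The identity -/

/-- Evaluation of a finite linear combination of arithmetic functions inside a Dirichlet product.
[folklore] -/
theorem mul_finset_sum_apply {ι : Type*} (s : Finset ι) (F : ArithmeticFunction ℝ) (c : ι → ℝ)
    (G : ι → ArithmeticFunction ℝ) (n : ℕ) :
    (∑ x ∈ n.divisorsAntidiagonal, F x.1 * ∑ i ∈ s, c i * G i x.2) =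
      ∑ i ∈ s, c i * (F * G i) n := by
  simp only [ArithmeticFunction.mul_apply, Finset.mul_sum]
  rw [Finset.sum_comm]
  exact Finset.sum_congr rfl fun i _ => Finset.sum_congr rfl fun x _ => by ring

/-- **Heath-Brown's identity for the Liouville function.**  For `k ≥ 1`, `z ≥ 0`, a squares cutoff `K`
and `m ≤ z^k`:
`λ(m) = ∑_{j=1}^{k} (−1)^{j+1} C(k,j) (∏_{i<2j} hbFactor K ⌊z⌋ j i)(m) + (1_{□,>K} ⋆ μ)(m)`,
i.e. `λ = 1_{□,≤K} ⋆ μ + 1_{□,>K} ⋆ μ` with `μ` expanded by `heathBrown_identity_moebius` in the first term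
(every `d ∣ m` has `d ≤ m ≤ z^k`). [cite: Heathbrown1982, Lemma 1] -/
theorem liouville_apply_eq {k : ℕ} (hk : 1 ≤ k) (K : ℕ) {z : ℝ} (hz : 0 ≤ z) {m : ℕ} (hm : (m : ℝ) ≤ z ^ k) :
    (liouville m : ℝ) =
      ∑ j ∈ Icc 1 k, (-1 : ℝ) ^ (j + 1) * (k.choose j : ℝ) *
          (∏ i ∈ Finset.range (2 * j), hbFactor K ⌊z⌋₊ j i) m +
        (sqIndGt K * (μ : ArithmeticFunction ℝ)) m := by
  -- `λ = (1_{□,≤K} + 1_{□,>K}) ⋆ μ`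
  have hlam : (liouville m : ℝ) = ((sqIndLe K + sqIndGt K) * (μ : ArithmeticFunction ℝ)) m := by
    rw [sqIndLe_add_sqIndGt]
    have h := congrArg (fun f : ArithmeticFunction ℝ => f m)
      LiouvilleSum.coe_liouville_eq_zeta_mul_liouville_mul_moebius
    simp only [ArithmeticFunction.intCoe_apply] at h
    exact h
  rw [hlam, add_mul, ArithmeticFunction.add_apply, add_left_inj]
  -- expand `μ` inside `1_{□,≤K} ⋆ μ`
  rw [ArithmeticFunction.mul_apply]
  have hHB : ∀ x ∈ m.divisorsAntidiagonal, sqIndLe K x.1 * ((μ : ArithmeticFunction ℝ) x.2) =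
      sqIndLe K x.1 * ∑ j ∈ Icc 1 k, ((-1 : ℝ) ^ (j + 1) * (k.choose j : ℝ)) *
        ((moebiusTrunc ⌊z⌋₊ : ArithmeticFunction ℝ) ^ j * (ζ : ArithmeticFunction ℝ) ^ (j - 1)) x.2 := by
    intro x hx
    rw [Nat.mem_divisorsAntidiagonal] at hx
    have hx2 : (x.2 : ℝ) ≤ z ^ k := by
      have : x.2 ≤ m := Nat.le_of_dvd (Nat.pos_of_ne_zero hx.2) ⟨x.1, by rw [mul_comm]; exact hx.1.symm⟩
      exact le_trans (by exact_mod_cast this) hm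
    rw [ArithmeticFunction.intCoe_apply, heathBrown_identity_moebius hk hz hx2]
  rw [Finset.sum_congr rfl hHB, mul_finset_sum_apply]
  refine Finset.sum_congr rfl fun j hj => ?_
  rw [Finset.mem_Icc] at hj
  rw [prod_range_hbFactor K ⌊z⌋₊ hj.1, mul_assoc (sqIndLe K)]

/-- The same with a natural truncation point `U` and `m ≤ U^k`. [cite: Heathbrown1982, Lemma 1] -/
theorem liouville_apply_eq_nat {k : ℕ} (hk : 1 ≤ k) (K U : ℕ) {m : ℕ} (hm : m ≤ U ^ k) :
    (liouville m : ℝ) =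
      ∑ j ∈ Icc 1 k, (-1 : ℝ) ^ (j + 1) * (k.choose j : ℝ) *
          (∏ i ∈ Finset.range (2 * j), hbFactor K U j i) m +
        (sqIndGt K * (μ : ArithmeticFunction ℝ)) m := by
  have h := liouville_apply_eq hk K (Nat.cast_nonneg U) (m := m) (by exact_mod_cast hm)
  rwa [Nat.floor_natCast] at h

/-! ### The squares tail -/

/-- `∑_{m ∈ S} |(1_{□,>K} ⋆ μ)(m)| ≤ #{(a, b) : a > K a square, ab ∈ S} ≤ ∑_{K < a ≤ N, a = □} N/a` for
`S ⊆ [1, N]`. [folklore] -/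
theorem sum_abs_sqIndGt_mul_moebius_le (K N : ℕ) :
    ∑ m ∈ Ioc 0 N, |(sqIndGt K * (μ : ArithmeticFunction ℝ)) m| ≤
      ∑ a ∈ Ioc K N, (if IsSquare a then (1 : ℝ) else 0) * (N / a : ℕ) := by
  calc ∑ m ∈ Ioc 0 N, |(sqIndGt K * (μ : ArithmeticFunction ℝ)) m|
      ≤ ∑ m ∈ Ioc 0 N, ∑ x ∈ m.divisorsAntidiagonal, sqIndGt K x.1 * 1 := by
        refine Finset.sum_le_sum fun m _ => ?_
        rw [ArithmeticFunction.mul_apply]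
        refine (Finset.abs_sum_le_sum_abs _ _).trans (Finset.sum_le_sum fun x _ => ?_)
        rw [abs_mul]
        have h1 : |sqIndGt K x.1| = sqIndGt K x.1 := by
          rw [sqIndGt_apply]; split_ifs
          · simp
          · rcases sqInd_mem x.1 with h | h <;> rw [h] <;> simp
        have h2 : |((μ : ArithmeticFunction ℝ) x.2)| ≤ 1 := by
          rw [ArithmeticFunction.intCoe_apply]; exact_mod_cast ArithmeticFunction.abs_moebius_le_one
        rw [h1]
        exact mul_le_mul_of_nonneg_left h2 (by rw [← h1]; exact abs_nonneg _)
    _ = ∑ a ∈ Ioc 0 N, ∑ b ∈ Ioc 0 (N / a), sqIndGt K a * 1 :=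
        Vaughan.sum_Ioc_sum_divisorsAntidiagonal_eq (fun a _ => sqIndGt K a * 1) N
    _ = ∑ a ∈ Ioc 0 N, sqIndGt K a * (N / a : ℕ) := by
        refine Finset.sum_congr rfl fun a _ => ?_
        rw [Finset.sum_const, Nat.card_Ioc, nsmul_eq_mul]
        simp [mul_comm]
    _ = ∑ a ∈ (Ioc 0 N).filter (fun a => K < a), sqInd a * (N / a : ℕ) := by
        rw [Finset.sum_filter]
        refine Finset.sum_congr rfl fun a _ => ?_
        by_cases h : K < a
        · rw [if_pos h, sqIndGt_apply, if_neg (by omega)]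
        · rw [if_neg h, sqIndGt_apply, if_pos (by omega), zero_mul]
    _ = ∑ a ∈ Ioc K N, (if IsSquare a then (1 : ℝ) else 0) * (N / a : ℕ) := by
        have hset : (Ioc 0 N).filter (fun a => K < a) = Ioc K N := by
          ext a
          simp only [Finset.mem_filter, Finset.mem_Ioc]
          omega
        rw [hset]
        refine Finset.sum_congr rfl fun a ha => ?_
        rw [Finset.mem_Ioc] at ha
        have ha0 : a ≠ 0 := by omega
        rw [sqInd_apply]
        simp [ha0]

end HeathBrownLiouville

end Literature.NumberTheory.Sieve

end
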